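import Summits.BirchSwinnertonDyer.BirchSwinnertonDyer.Theorems.GenusKolyvaginAtTwoGenusDeepSupplyAtTwoNegDiscNarrowOfKernels
import HarnessLib

/-!
# Route `GenusKolyvaginAtTwo`, crux 23491 `GenusDeepSupplyAtTwoNegDiscNarrow`: the registered stub C‴ SPLIT BY THE SELMER CELL
# (LEAD gk2-p1 g21; memo `DEPTH-ZERO-REDUCTION-CRITERION-g21.md` §1/§4)

`--supports stmt-BirchSwinnertonDyer-23491 --as helper`.  THEOREMS ONLY; pure logic over the registered texts.  **BSD is NOT proved by this file and no
item is closed by it.**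

The registered reshaped stub C‴ (`stub_genusPrimitivityAtTwo` of skeleton «genus_deep_supply_narrow» v5; = hypothesis `hC` of p760906
`GenusSupplyNarrow.genusDeepSupplyAtTwoNegDiscNarrow_of_items_of_stubC`) quantifies over BOTH narrow Selmer cells `#Sel₂(E) ∈ {1, 4}` and carries
`1 ≤ M₀`.  On the `#Sel₂(E) = 1` cell BSD (and, modulo Q2, SANDWICH′ + Cassels–Tate + L_T) force `M₀ = 0`, so there C‴ can only hold VACUOUSLY:
its content is the kernel **K₁ = «on the `#Sel₂(E) = 1` cell the frame with `1 ≤ M₀` is contradictory»** (= Kolyvagin's conjecture BASE CASE at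
`p = 2`: `y_K ∉ 2E(K[1])`; decided by the depth-zero reduction criterion p761607/p762095 once its reduction hypothesis is met).  On the `#Sel₂(E) = 4`
cell PAIRCOUNT forces `M₀ ≥ 1` and the kernel is **K₄ = C‴ restricted to `#Sel₂(E) = 4`** (genuine deep `2`-primitivity).  This file records the
recombination **C‴ ⟸ K₁ ∧ K₄** (`stubC_negDisc_of_selmerSplit`) and hence the deciding crux from FIVE ROUTE ITEMS + K₁ + K₄
(`genusDeepSupplyAtTwoNegDiscNarrow_of_items_of_selmerSplit`), so the pen may file the two cells as separate kernel items.

References: [GrossLMS1991] §3 (3.5), §4 (4.1); [McCallumLMS1991] §5; [WZhang2014] Thm. 1.1 / Thm. 9.3 (base case, `p ≥ 5`); [KrizLi2019] §5.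
-/

set_option autoImplicit false
set_option linter.dupNamespace false -- `Summit.<P>.<Sub>` repeats `BirchSwinnertonDyer` (D-0017)

noncomputable section

open scoped Classical

namespace Summit.BirchSwinnertonDyer.BirchSwinnertonDyer.Theorems.GenusSupplyNarrow

open WeierstrassCurve Literature.NumberTheory.EllipticCurves Literature.NumberTheory.EllipticCurves.ModularForms
  Summit.BirchSwinnertonDyer.BirchSwinnertonDyer.Theses.GenusKolyvaginAtTwo

/-- **C‴ ⟸ K₁ ∧ K₄ (split of the registered stub by the Selmer cell).**  K₁: on `#Sel₂(E) = 1` the C‴-frame with `1 ≤ M₀` is contradictory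
(`… → False`; i.e. `M₀ = 0` there — the base case of Kolyvagin's conjecture at `2`).  K₄: C‴ with the Selmer hypothesis specialised to
`#Sel₂(E) = 4`.  Pure logic (case split on the crux's `h14`).  [cite: GrossLMS1991, §4 (4.1)] -/
theorem stubC_negDisc_of_selmerSplit
    (hK1 : ∀ (W : WeierstrassCurve ℚ) [W.IsElliptic] [W.IsGloballyMinimal] [NeZero (W.conductorNorm ℤ)],
      ¬ W.HasCM → W.analyticRank = 0 → (∀ n : ℕ, 0 < n → W.HasSurjectiveModNGaloisRep ((2 : ℤ) ^ n)) →
      Odd W.tamagawaProduct → W.Δ < 0 → Nat.card (W.selmerGroup 2) = 1 →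
      ∀ (K : Type) [Field K] [NumberField K],
      IsImaginaryQuadratic K → Odd (NumberField.discr K) → NumberField.discr K ≠ -3 →
      SatisfiesHeegnerHypothesis (W.conductorNorm ℤ) K →
      ¬ IsSquare ((NumberField.discr K : ℚ) * -|W.Δ|) → ¬ IsSquare ((NumberField.discr K : ℚ) * (-(2 * |W.Δ|))) →
      ∀ (Dt : ModularParametrizationData W (W.conductorNorm ℤ)),
      (∀ z ∈ Dt.L.lattice, ∃ w ∈ periodLattice Dt.f, z = (Dt.c : ℂ) * w) → Odd Dt.c →
      ∀ (β : ℤ) (ι : K →+* ℂ) (d₁ : KolyvaginHeegnerData Dt β ι 1), ¬ IsOfFinAddOrder d₁.derivedPoint →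
      ∀ (M₀ : ℕ), (∃ Q : (W.baseChange (ringClassField K ι 1)).toAffine.Point, ((2 ^ M₀ : ℕ) : ℤ) • Q = d₁.derivedPoint) →
      (¬ ∃ Q : (W.baseChange (ringClassField K ι 1)).toAffine.Point, ((2 ^ (M₀ + 1) : ℕ) : ℤ) • Q = d₁.derivedPoint) →
      1 ≤ M₀ →
      ∀ (Wd : WeierstrassCurve ℚ) [Wd.IsElliptic] [Wd.IsGloballyMinimal],
      (∃ C : WeierstrassCurve.VariableChange ℚ, C • W.quadraticTwist (NumberField.discr K : ℚ) = Wd) →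
      Wd.analyticRank = 1 → Nat.card (Wd.selmerGroup 2) = 2 → padicValNat 2 Wd.tamagawaProduct ≤ 1 →
      False)
    (hK4 : ∀ (W : WeierstrassCurve ℚ) [W.IsElliptic] [W.IsGloballyMinimal] [NeZero (W.conductorNorm ℤ)],
      ¬ W.HasCM → W.analyticRank = 0 → (∀ n : ℕ, 0 < n → W.HasSurjectiveModNGaloisRep ((2 : ℤ) ^ n)) →
      Odd W.tamagawaProduct → W.Δ < 0 → Nat.card (W.selmerGroup 2) = 4 →
      ∀ (K : Type) [Field K] [NumberField K],
      IsImaginaryQuadratic K → Odd (NumberField.discr K) → NumberField.discr K ≠ -3 →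
      SatisfiesHeegnerHypothesis (W.conductorNorm ℤ) K →
      ¬ IsSquare ((NumberField.discr K : ℚ) * -|W.Δ|) → ¬ IsSquare ((NumberField.discr K : ℚ) * (-(2 * |W.Δ|))) →
      ∀ (Dt : ModularParametrizationData W (W.conductorNorm ℤ)),
      (∀ z ∈ Dt.L.lattice, ∃ w ∈ periodLattice Dt.f, z = (Dt.c : ℂ) * w) → Odd Dt.c →
      ∀ (β : ℤ) (ι : K →+* ℂ) (d₁ : KolyvaginHeegnerData Dt β ι 1), ¬ IsOfFinAddOrder d₁.derivedPoint →
      ∀ (M₀ : ℕ), (∃ Q : (W.baseChange (ringClassField K ι 1)).toAffine.Point, ((2 ^ M₀ : ℕ) : ℤ) • Q = d₁.derivedPoint) →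
      (¬ ∃ Q : (W.baseChange (ringClassField K ι 1)).toAffine.Point, ((2 ^ (M₀ + 1) : ℕ) : ℤ) • Q = d₁.derivedPoint) →
      1 ≤ M₀ →
      ∀ (Wd : WeierstrassCurve ℚ) [Wd.IsElliptic] [Wd.IsGloballyMinimal],
      (∃ C : WeierstrassCurve.VariableChange ℚ, C • W.quadraticTwist (NumberField.discr K : ℚ) = Wd) →
      Wd.analyticRank = 1 → Nat.card (Wd.selmerGroup 2) = 2 → padicValNat 2 Wd.tamagawaProduct ≤ 1 →
      ∃ (n : ℕ) (d : KolyvaginHeegnerData Dt β ι n), Squarefree n ∧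
        (∀ ℓ ∈ n.primeFactors, Zhang2014.IsKolyvaginPrime (W.conductorNorm ℤ) W K 2 ℓ ∧ 2 ≤ Zhang2014.kolyvaginIndex W 2 ℓ ∧
          FrobEqFrobInfty W K 2 ℓ) ∧
        ¬ ∃ Q : (W.baseChange (ringClassField K ι n)).toAffine.Point, (2 : ℤ) • Q = d.derivedPoint) :
    ∀ (W : WeierstrassCurve ℚ) [W.IsElliptic] [W.IsGloballyMinimal] [NeZero (W.conductorNorm ℤ)],
      ¬ W.HasCM → W.analyticRank = 0 → (∀ n : ℕ, 0 < n → W.HasSurjectiveModNGaloisRep ((2 : ℤ) ^ n)) →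
      Odd W.tamagawaProduct → W.Δ < 0 → (Nat.card (W.selmerGroup 2) = 1 ∨ Nat.card (W.selmerGroup 2) = 4) →
      ∀ (K : Type) [Field K] [NumberField K],
      IsImaginaryQuadratic K → Odd (NumberField.discr K) → NumberField.discr K ≠ -3 →
      SatisfiesHeegnerHypothesis (W.conductorNorm ℤ) K →
      ¬ IsSquare ((NumberField.discr K : ℚ) * -|W.Δ|) → ¬ IsSquare ((NumberField.discr K : ℚ) * (-(2 * |W.Δ|))) →
      ∀ (Dt : ModularParametrizationData W (W.conductorNorm ℤ)),
      (∀ z ∈ Dt.L.lattice, ∃ w ∈ periodLattice Dt.f, z = (Dt.c : ℂ) * w) → Odd Dt.c →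
      ∀ (β : ℤ) (ι : K →+* ℂ) (d₁ : KolyvaginHeegnerData Dt β ι 1), ¬ IsOfFinAddOrder d₁.derivedPoint →
      ∀ (M₀ : ℕ), (∃ Q : (W.baseChange (ringClassField K ι 1)).toAffine.Point, ((2 ^ M₀ : ℕ) : ℤ) • Q = d₁.derivedPoint) →
      (¬ ∃ Q : (W.baseChange (ringClassField K ι 1)).toAffine.Point, ((2 ^ (M₀ + 1) : ℕ) : ℤ) • Q = d₁.derivedPoint) →
      1 ≤ M₀ →
      ∀ (Wd : WeierstrassCurve ℚ) [Wd.IsElliptic] [Wd.IsGloballyMinimal],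
      (∃ C : WeierstrassCurve.VariableChange ℚ, C • W.quadraticTwist (NumberField.discr K : ℚ) = Wd) →
      Wd.analyticRank = 1 → Nat.card (Wd.selmerGroup 2) = 2 → padicValNat 2 Wd.tamagawaProduct ≤ 1 →
      ∃ (n : ℕ) (d : KolyvaginHeegnerData Dt β ι n), Squarefree n ∧
        (∀ ℓ ∈ n.primeFactors, Zhang2014.IsKolyvaginPrime (W.conductorNorm ℤ) W K 2 ℓ ∧ 2 ≤ Zhang2014.kolyvaginIndex W 2 ℓ ∧
          FrobEqFrobInfty W K 2 ℓ) ∧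
        ¬ ∃ Q : (W.baseChange (ringClassField K ι n)).toAffine.Point, (2 : ℤ) • Q = d.derivedPoint := by
  intro W _ _ _ hcm hr0 hρ hT hneg h14 K _ _ hIQ hodd h3 hHe hsq1 hsq2 Dt hoptDt hc β ι d₁ hy M₀ hdiv hndiv hM Wd _ _ hWd hrd hSel hDEF
  rcases h14 with h1 | h4
  · exact (hK1 W hcm hr0 hρ hT hneg h1 K hIQ hodd h3 hHe hsq1 hsq2 Dt hoptDt hc β ι d₁ hy M₀ hdiv hndiv hM Wd hWd hrd hSel hDEF).elim
  · exact hK4 W hcm hr0 hρ hT hneg h4 K hIQ hodd h3 hHe hsq1 hsq2 Dt hoptDt hc β ι d₁ hy M₀ hdiv hndiv hM Wd hWd hrd hSel hDEF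

/-- **THE DECIDING Δ<0 CRUX FROM FIVE ROUTE ITEMS + K₁ + K₄** (p760906 ∘ `stubC_negDisc_of_selmerSplit`).  CONDITIONAL.  BSD is NOT proved by this.
[cite: GrossZagier1986, Thm. I.6.3 with V.§2] [cite: MazurRubin2010, Prop. 3.3, Cor. 3.4 (i)] [cite: GrossLMS1991, §3 (3.5), §4 (4.1)] -/
theorem genusDeepSupplyAtTwoNegDiscNarrow_of_items_of_selmerSplit (hGZ : GrossZagierAllLevels) (hmod : ModularityExistsNewform)
    (hpar : TwoParityDD) (hconv : RankOneTwoConverse) (hconv' : RankOneTwoConverseOffSemistableAtTwo)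
    (hK1 : ∀ (W : WeierstrassCurve ℚ) [W.IsElliptic] [W.IsGloballyMinimal] [NeZero (W.conductorNorm ℤ)],
      ¬ W.HasCM → W.analyticRank = 0 → (∀ n : ℕ, 0 < n → W.HasSurjectiveModNGaloisRep ((2 : ℤ) ^ n)) →
      Odd W.tamagawaProduct → W.Δ < 0 → Nat.card (W.selmerGroup 2) = 1 →
      ∀ (K : Type) [Field K] [NumberField K],
      IsImaginaryQuadratic K → Odd (NumberField.discr K) → NumberField.discr K ≠ -3 →
      SatisfiesHeegnerHypothesis (W.conductorNorm ℤ) K →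
      ¬ IsSquare ((NumberField.discr K : ℚ) * -|W.Δ|) → ¬ IsSquare ((NumberField.discr K : ℚ) * (-(2 * |W.Δ|))) →
      ∀ (Dt : ModularParametrizationData W (W.conductorNorm ℤ)),
      (∀ z ∈ Dt.L.lattice, ∃ w ∈ periodLattice Dt.f, z = (Dt.c : ℂ) * w) → Odd Dt.c →
      ∀ (β : ℤ) (ι : K →+* ℂ) (d₁ : KolyvaginHeegnerData Dt β ι 1), ¬ IsOfFinAddOrder d₁.derivedPoint →
      ∀ (M₀ : ℕ), (∃ Q : (W.baseChange (ringClassField K ι 1)).toAffine.Point, ((2 ^ M₀ : ℕ) : ℤ) • Q = d₁.derivedPoint) →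
      (¬ ∃ Q : (W.baseChange (ringClassField K ι 1)).toAffine.Point, ((2 ^ (M₀ + 1) : ℕ) : ℤ) • Q = d₁.derivedPoint) →
      1 ≤ M₀ →
      ∀ (Wd : WeierstrassCurve ℚ) [Wd.IsElliptic] [Wd.IsGloballyMinimal],
      (∃ C : WeierstrassCurve.VariableChange ℚ, C • W.quadraticTwist (NumberField.discr K : ℚ) = Wd) →
      Wd.analyticRank = 1 → Nat.card (Wd.selmerGroup 2) = 2 → padicValNat 2 Wd.tamagawaProduct ≤ 1 →
      False)
    (hK4 : ∀ (W : WeierstrassCurve ℚ) [W.IsElliptic] [W.IsGloballyMinimal] [NeZero (W.conductorNorm ℤ)],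
      ¬ W.HasCM → W.analyticRank = 0 → (∀ n : ℕ, 0 < n → W.HasSurjectiveModNGaloisRep ((2 : ℤ) ^ n)) →
      Odd W.tamagawaProduct → W.Δ < 0 → Nat.card (W.selmerGroup 2) = 4 →
      ∀ (K : Type) [Field K] [NumberField K],
      IsImaginaryQuadratic K → Odd (NumberField.discr K) → NumberField.discr K ≠ -3 →
      SatisfiesHeegnerHypothesis (W.conductorNorm ℤ) K →
      ¬ IsSquare ((NumberField.discr K : ℚ) * -|W.Δ|) → ¬ IsSquare ((NumberField.discr K : ℚ) * (-(2 * |W.Δ|))) →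
      ∀ (Dt : ModularParametrizationData W (W.conductorNorm ℤ)),
      (∀ z ∈ Dt.L.lattice, ∃ w ∈ periodLattice Dt.f, z = (Dt.c : ℂ) * w) → Odd Dt.c →
      ∀ (β : ℤ) (ι : K →+* ℂ) (d₁ : KolyvaginHeegnerData Dt β ι 1), ¬ IsOfFinAddOrder d₁.derivedPoint →
      ∀ (M₀ : ℕ), (∃ Q : (W.baseChange (ringClassField K ι 1)).toAffine.Point, ((2 ^ M₀ : ℕ) : ℤ) • Q = d₁.derivedPoint) →
      (¬ ∃ Q : (W.baseChange (ringClassField K ι 1)).toAffine.Point, ((2 ^ (M₀ + 1) : ℕ) : ℤ) • Q = d₁.derivedPoint) →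
      1 ≤ M₀ →
      ∀ (Wd : WeierstrassCurve ℚ) [Wd.IsElliptic] [Wd.IsGloballyMinimal],
      (∃ C : WeierstrassCurve.VariableChange ℚ, C • W.quadraticTwist (NumberField.discr K : ℚ) = Wd) →
      Wd.analyticRank = 1 → Nat.card (Wd.selmerGroup 2) = 2 → padicValNat 2 Wd.tamagawaProduct ≤ 1 →
      ∃ (n : ℕ) (d : KolyvaginHeegnerData Dt β ι n), Squarefree n ∧
        (∀ ℓ ∈ n.primeFactors, Zhang2014.IsKolyvaginPrime (W.conductorNorm ℤ) W K 2 ℓ ∧ 2 ≤ Zhang2014.kolyvaginIndex W 2 ℓ ∧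
          FrobEqFrobInfty W K 2 ℓ) ∧
        ¬ ∃ Q : (W.baseChange (ringClassField K ι n)).toAffine.Point, (2 : ℤ) • Q = d.derivedPoint) :
    GenusDeepSupplyAtTwoNegDiscNarrow :=
  genusDeepSupplyAtTwoNegDiscNarrow_of_items_of_stubC hGZ hmod hpar hconv hconv' (stubC_negDisc_of_selmerSplit hK1 hK4)

/-- **K₁ in `M₀`-free form**: if on the `#Sel₂(E) = 1` cell one proves directly that `y_K = P(1)` is NOT `2`-divisible in `E(K[1])`
(`¬ ∃ Q, 2 • Q = P(1)` — the conclusion of the depth-zero reduction criterion), then K₁ holds (a `2^M₀`-th root with `1 ≤ M₀` gives a square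
root: `Q ↦ 2^(M₀−1) • Q`).  Pure bookkeeping.  [cite: McCallumLMS1991, §5 Lemma 5.1] -/
theorem K1_of_not_two_dvd
    (h : ∀ (W : WeierstrassCurve ℚ) [W.IsElliptic] [W.IsGloballyMinimal] [NeZero (W.conductorNorm ℤ)],
      ¬ W.HasCM → W.analyticRank = 0 → (∀ n : ℕ, 0 < n → W.HasSurjectiveModNGaloisRep ((2 : ℤ) ^ n)) →
      Odd W.tamagawaProduct → W.Δ < 0 → Nat.card (W.selmerGroup 2) = 1 →
      ∀ (K : Type) [Field K] [NumberField K],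
      IsImaginaryQuadratic K → Odd (NumberField.discr K) → NumberField.discr K ≠ -3 →
      SatisfiesHeegnerHypothesis (W.conductorNorm ℤ) K →
      ¬ IsSquare ((NumberField.discr K : ℚ) * -|W.Δ|) → ¬ IsSquare ((NumberField.discr K : ℚ) * (-(2 * |W.Δ|))) →
      ∀ (Dt : ModularParametrizationData W (W.conductorNorm ℤ)),
      (∀ z ∈ Dt.L.lattice, ∃ w ∈ periodLattice Dt.f, z = (Dt.c : ℂ) * w) → Odd Dt.c →
      ∀ (β : ℤ) (ι : K →+* ℂ) (d₁ : KolyvaginHeegnerData Dt β ι 1), ¬ IsOfFinAddOrder d₁.derivedPoint →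
      ∀ (Wd : WeierstrassCurve ℚ) [Wd.IsElliptic] [Wd.IsGloballyMinimal],
      (∃ C : WeierstrassCurve.VariableChange ℚ, C • W.quadraticTwist (NumberField.discr K : ℚ) = Wd) →
      Wd.analyticRank = 1 → Nat.card (Wd.selmerGroup 2) = 2 → padicValNat 2 Wd.tamagawaProduct ≤ 1 →
      ¬ ∃ Q : (W.baseChange (ringClassField K ι 1)).toAffine.Point, (2 : ℤ) • Q = d₁.derivedPoint) :
    ∀ (W : WeierstrassCurve ℚ) [W.IsElliptic] [W.IsGloballyMinimal] [NeZero (W.conductorNorm ℤ)],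
      ¬ W.HasCM → W.analyticRank = 0 → (∀ n : ℕ, 0 < n → W.HasSurjectiveModNGaloisRep ((2 : ℤ) ^ n)) →
      Odd W.tamagawaProduct → W.Δ < 0 → Nat.card (W.selmerGroup 2) = 1 →
      ∀ (K : Type) [Field K] [NumberField K],
      IsImaginaryQuadratic K → Odd (NumberField.discr K) → NumberField.discr K ≠ -3 →
      SatisfiesHeegnerHypothesis (W.conductorNorm ℤ) K →
      ¬ IsSquare ((NumberField.discr K : ℚ) * -|W.Δ|) → ¬ IsSquare ((NumberField.discr K : ℚ) * (-(2 * |W.Δ|))) →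
      ∀ (Dt : ModularParametrizationData W (W.conductorNorm ℤ)),
      (∀ z ∈ Dt.L.lattice, ∃ w ∈ periodLattice Dt.f, z = (Dt.c : ℂ) * w) → Odd Dt.c →
      ∀ (β : ℤ) (ι : K →+* ℂ) (d₁ : KolyvaginHeegnerData Dt β ι 1), ¬ IsOfFinAddOrder d₁.derivedPoint →
      ∀ (M₀ : ℕ), (∃ Q : (W.baseChange (ringClassField K ι 1)).toAffine.Point, ((2 ^ M₀ : ℕ) : ℤ) • Q = d₁.derivedPoint) →
      (¬ ∃ Q : (W.baseChange (ringClassField K ι 1)).toAffine.Point, ((2 ^ (M₀ + 1) : ℕ) : ℤ) • Q = d₁.derivedPoint) →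
      1 ≤ M₀ →
      ∀ (Wd : WeierstrassCurve ℚ) [Wd.IsElliptic] [Wd.IsGloballyMinimal],
      (∃ C : WeierstrassCurve.VariableChange ℚ, C • W.quadraticTwist (NumberField.discr K : ℚ) = Wd) →
      Wd.analyticRank = 1 → Nat.card (Wd.selmerGroup 2) = 2 → padicValNat 2 Wd.tamagawaProduct ≤ 1 →
      False := by
  intro W _ _ _ hcm hr0 hρ hT hneg h1 K _ _ hIQ hodd h3 hHe hsq1 hsq2 Dt hoptDt hc β ι d₁ hy M₀ hdiv _hndiv hM Wd _ _ hWd hrd hSel hDEF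
  obtain ⟨Q, hQ⟩ := hdiv
  refine h W hcm hr0 hρ hT hneg h1 K hIQ hodd h3 hHe hsq1 hsq2 Dt hoptDt hc β ι d₁ hy Wd hWd hrd hSel hDEF ⟨((2 ^ (M₀ - 1) : ℕ) : ℤ) • Q, ?_⟩
  rw [smul_smul, ← hQ]
  congr 1
  have h2 : 2 * 2 ^ (M₀ - 1) = 2 ^ M₀ := by
    rw [← pow_succ']
    congr 1
    omega
  exact_mod_cast h2

end Summit.BirchSwinnertonDyer.BirchSwinnertonDyer.Theorems.GenusSupplyNarrow

end
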